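import Mathlib
import HarnessLib
import Literature.Computability.AlgebraicComplexity.PatternExpressions
import Summits.ValiantsHypothesis.ValiantsHypothesis.Theorems.MonotoneRestorationMonotoneRestorationQPHomExpansionUnique

/-!
# Homomorphism polynomials: basic calculus (isomorphism invariance, homogeneity, isolated vertices,
# disjoint unions) and the Mathlib form of the uniqueness of expansions

Route MonotoneRestoration; items `OrbitRestorationLinearVolumeQP` (stmt-ValiantsHypothesis-18294, whose hypothesis class
is literally "`f n = Σ_i α_{n,i} · homPoly (E n i) n ℂ` with linear volume and polynomial dimension") and
`MonotoneRestorationQP` (stmt-15886, line `linear-width`).  The informal statements of both items use, without a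
tree proof so far, the elementary calculus of homomorphism polynomials of bipartite multigraph patterns
`F = (A ⊔ B, E)` on the `n × n` matrix (tree `homPoly`, Dwivedi–Pago–Seppelt 2026 eq. (1)):

* `homPoly_map_equiv` — isomorphic patterns have the same homomorphism polynomial;
* `isHomogeneous_homPoly`, `totalDegree_homPoly_le` — `hom_{F,n}` is homogeneous of degree `|E|`;
* `homPoly_optionRow`, `homPoly_optionCol` — an ISOLATED vertex only rescales: `hom_{F + vertex,n} = n · hom_{F,n}`
  ("isolated vertices … only rescale", informal statement of stmt-18294);
* `homPoly_disjointUnion` — DISJOINT UNIONS multiply: `hom_{F₁ ⊔ F₂,n} = hom_{F₁,n} · hom_{F₂,n}`;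
* `linearIndependent_homPoly` — the uniqueness of expansions at volume `≤ n`
  (`HomExpansionUnique.homPoly_linearIndependent`, DPS26 Lemma 8.18) in Mathlib's `LinearIndependent` form, and
  `homPoly_expansion_unique` — two expansions over the same admissible pattern family have the same coefficients.

Honest framing: helper calculus for OPEN items; nothing here is progress on `VP ≠ VNP`.
[cite: DwivediPagoSeppelt2026, eq. (1) and Lemma 8.18 (p. 34)]
-/

noncomputable section

open MvPolynomial

-- `Summit.ValiantsHypothesis.ValiantsHypothesis.…` is the tree's single-conjunct layout (Sub = Summit).
set_option linter.dupNamespace false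

namespace Summit.ValiantsHypothesis.ValiantsHypothesis.Theorems

namespace HomPolyBasics

open Literature.Computability.AlgebraicComplexity

universe u

section Semiring

variable {K : Type*} [CommSemiring K]

/-! ### Isomorphism invariance -/

/-- **Isomorphic patterns have equal homomorphism polynomials**: relabelling the row-vertices along `ea` and the
column-vertices along `eb` does not change `hom_{F,n}`. [cite: DwivediPagoSeppelt2026, eq. (1)] -/
theorem homPoly_map_equiv {A B A' B' : Type u} [Fintype A] [DecidableEq A] [Fintype B] [DecidableEq B]
    [Fintype A'] [DecidableEq A'] [Fintype B'] [DecidableEq B'] (E : Multiset (A × B)) (ea : A ≃ A')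
    (eb : B ≃ B') (n : ℕ) :
    homPoly (E.map fun e => (ea e.1, eb e.2)) n K = homPoly E n K := by
  unfold homPoly
  simp only [Multiset.map_map, Function.comp_def]
  exact Fintype.sum_equiv ((ea.arrowCongr (Equiv.refl (Fin n))).prodCongr
    (eb.arrowCongr (Equiv.refl (Fin n)))).symm _ _ fun h => rfl

/-! ### Homogeneity -/

/-- A product of `|M|` variables is homogeneous of degree `|M|`. [folklore] -/
theorem isHomogeneous_prod_map_X {τ σ : Type*} (f : τ → σ) (M : Multiset τ) :
    ((M.map fun t => (X (f t) : MvPolynomial σ K)).prod).IsHomogeneous (Multiset.card M) := by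
  induction M using Multiset.induction with
  | empty => simpa using isHomogeneous_one σ K
  | cons a M ih =>
    rw [Multiset.map_cons, Multiset.prod_cons, Multiset.card_cons, add_comm]
    exact (isHomogeneous_X K (f a)).mul ih

/-- **`hom_{F,n}` is homogeneous of degree `|E(F)|`.** [cite: DwivediPagoSeppelt2026, eq. (1)] -/
theorem isHomogeneous_homPoly {A B : Type u} [Fintype A] [DecidableEq A] [Fintype B] [DecidableEq B]
    (E : Multiset (A × B)) (n : ℕ) : (homPoly E n K).IsHomogeneous (Multiset.card E) := by
  unfold homPoly
  exact IsHomogeneous.sum _ _ _ fun h _ => isHomogeneous_prod_map_X (fun e : A × B => (h.1 e.1, h.2 e.2)) E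

/-- Hence `totalDegree hom_{F,n} ≤ |E(F)|`. [cite: DwivediPagoSeppelt2026, eq. (1)] -/
theorem totalDegree_homPoly_le {A B : Type u} [Fintype A] [DecidableEq A] [Fintype B] [DecidableEq B]
    (E : Multiset (A × B)) (n : ℕ) : (homPoly E n K).totalDegree ≤ Multiset.card E :=
  (isHomogeneous_homPoly E n).totalDegree_le

/-! ### Isolated vertices rescale -/

/-- **An isolated row-vertex rescales by `n`**: for the pattern on `Option A ⊔ B` whose edges are those of `F` (the new
row-vertex `none` is isolated), `hom = n · hom_F`. [cite: DwivediPagoSeppelt2026, eq. (1)] -/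
theorem homPoly_optionRow {A B : Type u} [Fintype A] [DecidableEq A] [Fintype B] [DecidableEq B]
    (E : Multiset (A × B)) (n : ℕ) :
    homPoly (E.map fun e => ((some e.1 : Option A), e.2)) n K = n • homPoly E n K := by
  unfold homPoly
  simp only [Multiset.map_map, Function.comp_def]
  have hconst : ∀ S : MvPolynomial (Fin n × Fin n) K, n • S = ∑ _v : Fin n, S := fun S => by simp
  rw [hconst, ← Fintype.sum_prod_type']
  exact Fintype.sum_equiv
    (((Equiv.piOptionEquivProd (β := fun _ : Option A => Fin n)).prodCongr (Equiv.refl (B → Fin n))).trans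
      (Equiv.prodAssoc (Fin n) (A → Fin n) (B → Fin n))) _ _ fun h => rfl

/-- **An isolated column-vertex rescales by `n`.** [cite: DwivediPagoSeppelt2026, eq. (1)] -/
theorem homPoly_optionCol {A B : Type u} [Fintype A] [DecidableEq A] [Fintype B] [DecidableEq B]
    (E : Multiset (A × B)) (n : ℕ) :
    homPoly (E.map fun e => (e.1, (some e.2 : Option B))) n K = n • homPoly E n K := by
  unfold homPoly
  simp only [Multiset.map_map, Function.comp_def]
  have hconst : ∀ S : MvPolynomial (Fin n × Fin n) K, n • S = ∑ _v : Fin n, S := fun S => by simp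
  rw [hconst, ← Fintype.sum_prod_type']
  exact Fintype.sum_equiv
    ((((Equiv.refl (A → Fin n)).prodCongr (Equiv.piOptionEquivProd (β := fun _ : Option B => Fin n))).trans
      (Equiv.prodAssoc (A → Fin n) (Fin n) (B → Fin n)).symm).trans
      (((Equiv.prodComm (A → Fin n) (Fin n)).prodCongr (Equiv.refl (B → Fin n))).trans
        (Equiv.prodAssoc (Fin n) (A → Fin n) (B → Fin n)))) _ _ fun h => rfl

/-! ### Disjoint unions multiply -/

/-- **Disjoint unions of patterns multiply**: for `F₁ = (A₁ ⊔ B₁, E₁)` and `F₂ = (A₂ ⊔ B₂, E₂)`, the pattern on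
`(A₁ ⊕ A₂) ⊔ (B₁ ⊕ B₂)` with edge multiset `E₁ ⊎ E₂` has `hom = hom_{F₁} · hom_{F₂}`. [cite: DwivediPagoSeppelt2026, eq. (1)] -/
theorem homPoly_disjointUnion {A₁ B₁ A₂ B₂ : Type u} [Fintype A₁] [DecidableEq A₁] [Fintype B₁] [DecidableEq B₁]
    [Fintype A₂] [DecidableEq A₂] [Fintype B₂] [DecidableEq B₂] (E₁ : Multiset (A₁ × B₁)) (E₂ : Multiset (A₂ × B₂))
    (n : ℕ) :
    homPoly ((E₁.map fun e => ((Sum.inl e.1 : A₁ ⊕ A₂), (Sum.inl e.2 : B₁ ⊕ B₂))) +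
        E₂.map fun e => ((Sum.inr e.1 : A₁ ⊕ A₂), (Sum.inr e.2 : B₁ ⊕ B₂))) n K =
      homPoly E₁ n K * homPoly E₂ n K := by
  unfold homPoly
  simp only [Multiset.map_add, Multiset.prod_add, Multiset.map_map, Function.comp_def]
  rw [Finset.sum_mul_sum, ← Fintype.sum_prod_type']
  exact Fintype.sum_equiv
    (((Equiv.sumArrowEquivProdArrow A₁ A₂ (Fin n)).prodCongr (Equiv.sumArrowEquivProdArrow B₁ B₂ (Fin n))).trans
      (Equiv.prodProdProdComm (A₁ → Fin n) (A₂ → Fin n) (B₁ → Fin n) (B₂ → Fin n))) _ _ fun h => rfl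

end Semiring

/-! ### Uniqueness of expansions, Mathlib form -/

section Field

variable {K : Type*} [Field K] [CharZero K]

/-- **Linear independence of homomorphism polynomials** (DPS26 Lemma 8.18, Mathlib form): for pairwise
non-isomorphic patterns without isolated vertices and with `≤ n` vertices per side, the family
`i ↦ hom_{F_i,n}` is `LinearIndependent`. [cite: DwivediPagoSeppelt2026, Lemma 8.18 (p. 34)] -/
theorem linearIndependent_homPoly (n m : ℕ) (a b : Fin m → ℕ)
    (E : (i : Fin m) → Multiset (Fin (a i) × Fin (b i)))
    (hle : ∀ i, a i ≤ n ∧ b i ≤ n)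
    (hrow : ∀ i (u : Fin (a i)), ∃ e ∈ E i, e.1 = u)
    (hcol : ∀ i (v : Fin (b i)), ∃ e ∈ E i, e.2 = v)
    (hiso : ∀ i j, i ≠ j → ∀ (ea : Fin (a i) ≃ Fin (a j)) (eb : Fin (b i) ≃ Fin (b j)),
      ((E i).map fun e => (ea e.1, eb e.2)) ≠ E j) :
    LinearIndependent K fun i : Fin m => homPoly (E i) n K := by
  rw [Fintype.linearIndependent_iff]
  intro g hg
  have h := HomExpansionUnique.homPoly_linearIndependent n m a b E g hle hrow hcol hiso
    (by simpa only [smul_eq_C_mul] using hg)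
  exact fun i => congrFun h i

/-- **Uniqueness of expansions** over an admissible pattern family: equal combinations have equal coefficients.
[cite: DwivediPagoSeppelt2026, Lemma 8.18 (p. 34)] -/
theorem homPoly_expansion_unique (n m : ℕ) (a b : Fin m → ℕ)
    (E : (i : Fin m) → Multiset (Fin (a i) × Fin (b i))) (α β : Fin m → K)
    (hle : ∀ i, a i ≤ n ∧ b i ≤ n)
    (hrow : ∀ i (u : Fin (a i)), ∃ e ∈ E i, e.1 = u)
    (hcol : ∀ i (v : Fin (b i)), ∃ e ∈ E i, e.2 = v)
    (hiso : ∀ i j, i ≠ j → ∀ (ea : Fin (a i) ≃ Fin (a j)) (eb : Fin (b i) ≃ Fin (b j)),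
      ((E i).map fun e => (ea e.1, eb e.2)) ≠ E j)
    (h : ∑ i, C (α i) * homPoly (E i) n K = ∑ i, C (β i) * homPoly (E i) n K) :
    α = β := by
  have h0 : ∑ i, C (α i - β i) * homPoly (E i) n K = 0 := by
    simp only [map_sub, sub_mul, Finset.sum_sub_distrib, h, sub_self]
  have := HomExpansionUnique.homPoly_linearIndependent n m a b E (fun i => α i - β i) hle hrow hcol hiso h0
  funext i
  exact sub_eq_zero.1 (congrFun this i)

end Field

end HomPolyBasics

end Summit.ValiantsHypothesis.ValiantsHypothesis.Theorems

end
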